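import Summits.CriticalPhenomena.PercolationContinuityZ3.Theorems.PercNearOneGluingNoHeavyQuantGatedSliceMixLawPRoutings
import Summits.CriticalPhenomena.PercolationContinuityZ3.Theorems.PercNearOneGluingNoHeavyQuantGatedSliceMixLawRegimeBCells
import HarnessLib

/-!
# QUANT lane R8, T-DEC, leg (III), blob case — `LawDec.GatedSliceMixLaw'` in regime B, the P-ALONE cells (the corrected Q3):
# `MixLawCellPCheap` IS A THEOREM, and `MixLawCellPDear` reduces to the single kink inequality (I_{U₁})

builds on p205010 (kernel theorem, internal audit signed; external expert review pending)

Support file (`--supports stmt-CriticalPhenomena-4575`), QUANT lane seat prim-quant-arm-2 (gen 36), rung R8 of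
`run/shared/lean/prim/quant/LADDER.md`; cells typed by census-2 g61 (`…QuantGatedSliceMixLawRegimeBCells`, the P-LEMMA of lane INBOX
l.1054) and handed to this seat (INBOX l.1088).  Theorems only, standard axioms, no sorries, no definitions.  Routings:
`…QuantGatedSliceMixLawPRoutings` (this seat), shell `mixLawQ_decAtT_of_routing_deep` (arm-1 g41).

THE CELLS (notation of `…PRoutings`: `P = z·δ₀ + m₁δ_{k₁} + m₁'δ_ℓ + m₂δ_{k₂} + m₂'δ_{k₂+a}`, `u = y/(1−y)`, `U_d = usage(ℓ,k₂)`,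
`U₁ = usage(k₁,k₂)`, `U₀ = t/(k₂−t)`).  P-CHEAP: `k₁` light at the mid and both lows fit (`U₁m₁ + U_dm₁' ≤ m₂`); P-DEAR: `k₁` dear and the mid
not saturated by `ℓ` (`U_dm₁' ≤ m₂`).  The exact criterion for `P` DEC is the dual kink family (I_X) (census-2 l.1054); the members (I_{U₀}) and
(I_{U_d}) follow from the mean identity (this seat, INBOX l.1065/l.1082), so:

* **`LawDec.mixLawCellPCheap_holds : MixLawCellPCheap`** — `k₁ = 0` heavy top, else `decAtT_movedTwoPoint_of_midFit`.
* `LawDec.decAtT_movedTwoPoint_of_kink` — `k₁` compatible, the mid short of room (`m₂ − U_dm₁' < U₁m₁`): `k₁` fills the leftover exactly,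
  its overflow and the zeros ride the giant — feasible iff the kink member **(I_{U₁}) `U₁(z + m₁) + U_dm₁' ≤ m₂ + U₁(1−y)/y·m₂'`**.
* **`LawDec.decAtT_movedTwoPoint_PDear_of_kink`** — the binder of `MixLawCellPDear` verbatim + (I_{U₁}) (as a hypothesis, only in that
  sub-case) ⟹ `P` DEC, by the dispatch heavy top / `…_of_incompLow` / `…_of_midFit` / `…_of_kink`.
(I_{U₁}) on the cell (k₁ dear) is the remaining real-algebra lemma: seat census 200 000 / 0; structure (lane INBOX l.1082, exact in ℚ):
`F(U₁)·(k₂−t+k₁) = 2k₁z + k₁m₁ + k₁m₂ + B₁m₁' − B₂m₂'`, `B₁ = (t−ℓ) − (k₂−t+k₁)·min(U_d,U₁) ≥ 0`, `B₂ = (k₂+a−2k₁) − (t−2k₁)/y ≤ a − k₁`.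
HONEST STATUS: `MixLawCellPDear` open modulo (I_{U₁}); `MixLawRegimeB`, `GatedSliceMixLaw'`, CW, `SingleGateConvClosed`, `TreeDEC`,
`FarTreeRow` OPEN; RATE class log* / honest sentence unchanged.

[this work]; routing shell: prim-quant-arm-1 g39–g41; cells: census-2 g61 (this lane).  Nothing here is cited as a published result.  The
gluing rows served [cite: KozmaNitzan2024, Conjecture 3 (p. 15)]; product measure [cite: Grimmett1999, §1.3 p. 10].
-/

noncomputable section

namespace Summit.CriticalPhenomena.PercolationContinuityZ3.Theorems

namespace Quant

open Finset

/-- the two-point law `{lo, hi; g}` (as in `…QuantLawDEC`) -/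
local notation3 "TP[" lo ", " hi ", " g ", " h "]" =>
  (g : ℝ) * (if (h : ℕ) = (hi : ℕ) then (1 : ℝ) else 0) + (1 - (g : ℝ)) * (if (h : ℕ) = (lo : ℕ) then (1 : ℝ) else 0)

namespace LawDec

/-! ### The kink routing -/

set_option maxHeartbeats 800000 in
/-- **`k₁` compatible, the mid short of room** (`k₁ ≥ 1`, `t < k₁ + k₂`, `m₂ − U_dm₁' < U₁m₁`): `P` is DEC if the kink member (I_{U₁})
`U₁(z + m₁) + U_dm₁' ≤ m₂ + U₁(1−y)/y·m₂'` holds — `k₁` fills the leftover exactly, its overflow and the zeros ride the giant. [this work] -/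
theorem decAtT_movedTwoPoint_of_kink (y z g S lam : ℝ) (a j M k₁ k₂ : ℕ)
    (hy0 : 0 < y) (hy1 : y < 1) (hz0 : 0 ≤ z) (hz1 : z < 1) (hg1 : g ≤ 1) (hyg : y ≤ (1 - z) * g) (ha1 : 1 ≤ a)
    (hta : y * (M : ℝ) ≤ S) (hk : k₁ ≤ k₂) (hk₂M : k₂ ≤ M) (hlam0 : 0 ≤ lam) (hlam1 : lam ≤ 1)
    (hmean : (1 - z) * ((k₁ : ℝ) + ((k₂ : ℝ) - k₁) * lam) = S)
    (hk₁ : 1 ≤ k₁) (hk₁low : 2 * (k₁ : ℝ) < S + (a : ℝ) * g * (1 - z)) (hPj : k₁ + a ≤ j)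
    (hPlow : 2 * ((k₁ + a : ℕ) : ℝ) < S + (a : ℝ) * g * (1 - z))
    (hk₂mid : S + (a : ℝ) * g * (1 - z) ≤ 2 * (k₂ : ℝ)) (hcomp : S + (a : ℝ) * g * (1 - z) < ((k₁ + a : ℕ) : ℝ) + k₂)
    (hG : j + 1 ≤ k₂ + a) (hnj : ¬ (j + 1 ≤ k₂)) (hc1 : S + (a : ℝ) * g * (1 - z) < (k₁ : ℝ) + k₂)
    (hsat : usage y (S + (a : ℝ) * g * (1 - z)) j (k₁ + a) k₂ * ((1 - z) * (1 - lam) * g) ≤ (1 - z) * lam * (1 - g))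
    (hL : (1 - z) * lam * (1 - g) - usage y (S + (a : ℝ) * g * (1 - z)) j (k₁ + a) k₂ * ((1 - z) * (1 - lam) * g)
      < usage y (S + (a : ℝ) * g * (1 - z)) j k₁ k₂ * ((1 - z) * (1 - lam) * (1 - g)))
    (hI : usage y (S + (a : ℝ) * g * (1 - z)) j k₁ k₂ * (z + (1 - z) * (1 - lam) * (1 - g))
        + usage y (S + (a : ℝ) * g * (1 - z)) j (k₁ + a) k₂ * ((1 - z) * (1 - lam) * g)
      ≤ (1 - z) * lam * (1 - g) + usage y (S + (a : ℝ) * g * (1 - z)) j k₁ k₂ * ((1 - y) / y) * ((1 - z) * lam * g)) :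
    DECAtT y (S + (a : ℝ) * g * (1 - z)) j (M + a)
      (fun p => z * (if p = 0 then (1 : ℝ) else 0) + (1 - z) * slice (fun q => TP[k₁, k₂, lam, q]) a g p) := by
  set t : ℝ := S + (a : ℝ) * g * (1 - z) with ht
  set U1 : ℝ := usage y t j k₁ k₂ with hU1d
  set Ud : ℝ := usage y t j (k₁ + a) k₂ with hUdd
  have h1z : 0 < 1 - z := by linarith
  have h1y : 0 < 1 - y := by linarith
  have hg0 : 0 < g := by nlinarith
  have hu0 : 0 < y / (1 - y) := div_pos hy0 h1y
  have ha0 : (0 : ℝ) ≤ a := Nat.cast_nonneg a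
  have hSt : S ≤ t := by rw [ht]; nlinarith [mul_nonneg (mul_nonneg ha0 hg0.le) h1z.le]
  have hS0 : 0 < S := by
    have hk₁r : (1 : ℝ) ≤ k₁ := by exact_mod_cast hk₁
    have : (a : ℝ) * g * (1 - z) ≤ a := by nlinarith [mul_nonneg ha0 hg0.le]
    have hdcast : ((k₁ + a : ℕ) : ℝ) = (k₁ : ℝ) + a := by push_cast; ring
    rw [hdcast] at hPlow
    linarith
  have htpos : 0 < t := by linarith
  set A : ℝ := (1 - z) * (1 - lam) * (1 - g) with hA
  set B : ℝ := (1 - z) * (1 - lam) * g with hB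
  set C : ℝ := (1 - z) * lam * (1 - g) with hC
  set D : ℝ := (1 - z) * lam * g with hD
  have hB0 : 0 ≤ B := mul_nonneg (mul_nonneg h1z.le (by linarith)) hg0.le
  have hU10 : 0 < U1 :=
    usage_pos_of_compat y t j k₁ k₂ hy0 hy1 hk₁low (by
      have : (k₁ : ℝ) < k₂ := by linarith
      exact_mod_cast this) (Or.inr hc1)
  have hUG : usage y t j k₁ (k₂ + a) = y / (1 - y) := usage_giant_eq y t j k₁ (k₂ + a) hG
  have hL0 : 0 ≤ C - Ud * B := by linarith
  set xK : ℝ := (C - Ud * B) / U1 with hxK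
  have hxK0 : 0 ≤ xK := div_nonneg hL0 hU10.le
  have hxKA : xK < A := by rw [hxK, div_lt_iff₀ hU10]; linarith
  have hxKload : U1 * xK = C - Ud * B := by rw [hxK]; field_simp
  -- the giant's budget: u(z + (A − xK)) ≤ D, from (I_{U₁}) multiplied by u/U1
  have hzA : y / (1 - y) * (z + (A - xK)) ≤ D := by
    have h2 : y / (1 - y) * (U1 * (z + A) + Ud * B) ≤ y / (1 - y) * (C + U1 * ((1 - y) / y) * D) :=
      mul_le_mul_of_nonneg_left hI hu0.le
    have e2 : y / (1 - y) * (C + U1 * ((1 - y) / y) * D) = y / (1 - y) * C + U1 * D := by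
      field_simp
    have e1 : y / (1 - y) * (z + (A - xK)) * U1 = y / (1 - y) * (U1 * (z + A) + Ud * B) - y / (1 - y) * C := by
      rw [hxK]; field_simp; ring
    have h3 : y / (1 - y) * (z + (A - xK)) * U1 ≤ D * U1 := by rw [e1]; linarith [h2, e2]
    exact le_of_mul_le_mul_right h3 hU10
  have hfin : t * z ≤ t * (1 - y) / y * (D - y / (1 - y) * (A - xK)) := by
    have e4 : t * (1 - y) / y * (D - y / (1 - y) * (A - xK)) = t * (1 - y) / y * D - t * (A - xK) := by
      field_simp
    have h6 := mul_le_mul_of_nonneg_left hzA (show 0 ≤ t * (1 - y) / y by positivity)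
    have e6 : t * (1 - y) / y * (y / (1 - y) * (z + (A - xK))) = t * z + t * (A - xK) := by
      field_simp
    linarith [h6, e6, e4]
  refine mixLawQ_decAtT_of_routing_deep y z g S lam a j M k₁ k₂ xK (A - xK) B 0 hy0 hy1 hz0 hz1 hg1 hyg ha1 hta hk hk₂M hlam0
    hlam1 hmean hk₁ hPj hPlow (Or.inl hk₂mid) hG hxK0 (by linarith) hB0 le_rfl (by ring) (by ring) (fun _ => Or.inr hc1)
    (fun _ => Or.inr hcomp) (by rw [hxKload]; linarith) ?_ ?_
  · rw [hUG, mul_zero, add_zero]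
    nlinarith [mul_nonneg hu0.le hz0]
  · rw [if_neg hnj, hUG, mul_zero, add_zero, hxKload]
    have e3 : C - (C - Ud * B + Ud * B) = 0 := by ring
    rw [e3, mul_zero, zero_add]
    exact hfin

/-! ### Cell P-CHEAP is a theorem; cell P-DEAR modulo (I_{U₁}) -/

/-- **`MixLawCellPCheap` HOLDS.**  `k₁ = 0`: the top is heavy (`y ≤ S/M ≤ S/k₂ = (1−z)λ`), `decAtT_movedTwoPoint_of_heavyTop`; `k₁ ≥ 1`
(light, hence compatible): `decAtT_movedTwoPoint_of_midFit`. [this work] -/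
theorem mixLawCellPCheap_holds : MixLawCellPCheap := by
  intro y z g S lam a j M k₁ k₂ hy0 hy1 hz0 hz1 hg1 hyg ha1 _hjM hS0 hta _hSj _hSM hk hk₂M hlam0 hlam1 hmean _hk₁j hk₁low hPj hPlow
    hk₂j hk₂mid hcomp hG hcheap hsat
  have hyk₂ : y * (k₂ : ℝ) ≤ S := le_trans (mul_le_mul_of_nonneg_left (by exact_mod_cast hk₂M) hy0.le) hta
  rcases Nat.eq_zero_or_pos k₁ with hk₁0 | hk₁pos
  · subst hk₁0
    have hk₂0 : (0 : ℝ) < k₂ := by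
      have : (0 : ℝ) < 2 * (k₂ : ℝ) := lt_of_lt_of_le (by
        have ha0 : (0 : ℝ) ≤ a := Nat.cast_nonneg a
        have hg0 : 0 < g := by nlinarith
        nlinarith [mul_nonneg (mul_nonneg ha0 hg0.le) (show (0:ℝ) ≤ 1 - z by linarith)]) hk₂mid
      linarith
    have hmean' : (1 - z) * lam * (k₂ : ℝ) = S := by rw [← hmean]; push_cast; ring
    have hheavy : y ≤ (1 - z) * lam := by
      have h1 : y * (k₂ : ℝ) ≤ (1 - z) * lam * (k₂ : ℝ) := by rw [hmean']; exact hyk₂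
      exact le_of_mul_le_mul_right h1 hk₂0
    exact decAtT_movedTwoPoint_of_heavyTop y z g S lam a j M 0 k₂ hy0 hy1 hz0 hz1 hg1 hyg ha1 hS0 hk hk₂M hlam1 hmean hheavy
  · have hk12 : (k₁ : ℝ) < k₂ := by
      by_contra hc
      have : (k₂ : ℝ) ≤ k₁ := not_lt.1 hc
      nlinarith
    have hc1 : S + (a : ℝ) * g * (1 - z) < (k₁ : ℝ) + k₂ := by nlinarith
    exact decAtT_movedTwoPoint_of_midFit y z g S lam a j M k₁ k₂ hy0 hy1 hz0 hz1 hg1 hyg ha1 hta hk hk₂M hlam0 hlam1 hmean hk₁pos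
      hk₁low hPj hPlow hk₂j hk₂mid hcomp hG hc1 (by linarith [hsat])

/-- **CELL P-DEAR FROM THE KINK MEMBER (I_{U₁}).**  The binder of `MixLawCellPDear` verbatim plus ONE real hypothesis, needed only when
`k₁` is compatible with the mid and does not fit next to `ℓ` (`m₂ − U_d m₁' < U₁ m₁`): (I_{U₁})
`U₁(z + m₁) + U_d m₁' ≤ m₂ + U₁·(1−y)/y·m₂'`.  Dispatch: `k₁ = 0` heavy top; `k₁` incompatible `decAtT_movedTwoPoint_of_incompLow`; compatible
and fitting `decAtT_movedTwoPoint_of_midFit`; else `decAtT_movedTwoPoint_of_kink`. [this work] -/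
theorem decAtT_movedTwoPoint_PDear_of_kink (y z g S lam : ℝ) (a j M k₁ k₂ : ℕ)
    (hy0 : 0 < y) (hy1 : y < 1) (hz0 : 0 ≤ z) (hz1 : z < 1) (hg1 : g ≤ 1) (hyg : y ≤ (1 - z) * g) (ha1 : 1 ≤ a)
    (_hjM : j < M + a) (hS0 : 0 < S) (hta : y * (M : ℝ) ≤ S) (_hSj : S < (j : ℝ)) (_hSM : S < (M : ℝ))
    (hk : k₁ ≤ k₂) (hk₂M : k₂ ≤ M) (hlam0 : 0 ≤ lam) (hlam1 : lam ≤ 1)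
    (hmean : (1 - z) * ((k₁ : ℝ) + ((k₂ : ℝ) - k₁) * lam) = S)
    (_hk₁j : k₁ ≤ j) (hk₁low : 2 * (k₁ : ℝ) < S + (a : ℝ) * g * (1 - z)) (hPj : k₁ + a ≤ j)
    (hPlow : 2 * ((k₁ + a : ℕ) : ℝ) < S + (a : ℝ) * g * (1 - z))
    (hk₂j : k₂ ≤ j) (hk₂mid : S + (a : ℝ) * g * (1 - z) ≤ 2 * (k₂ : ℝ)) (hcomp : S + (a : ℝ) * g * (1 - z) < ((k₁ + a : ℕ) : ℝ) + k₂)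
    (hG : j + 1 ≤ k₂ + a)
    (_hdear : y * ((k₂ : ℝ) - k₁) ≤ S + (a : ℝ) * g * (1 - z) - 2 * (k₁ : ℝ))
    (hsat : usage y (S + (a : ℝ) * g * (1 - z)) j (k₁ + a) k₂ * ((1 - z) * (1 - lam) * g) ≤ (1 - z) * lam * (1 - g))
    (hkink : S + (a : ℝ) * g * (1 - z) < (k₁ : ℝ) + k₂ →
      (1 - z) * lam * (1 - g) - usage y (S + (a : ℝ) * g * (1 - z)) j (k₁ + a) k₂ * ((1 - z) * (1 - lam) * g)
        < usage y (S + (a : ℝ) * g * (1 - z)) j k₁ k₂ * ((1 - z) * (1 - lam) * (1 - g)) →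
      usage y (S + (a : ℝ) * g * (1 - z)) j k₁ k₂ * (z + (1 - z) * (1 - lam) * (1 - g))
        + usage y (S + (a : ℝ) * g * (1 - z)) j (k₁ + a) k₂ * ((1 - z) * (1 - lam) * g)
      ≤ (1 - z) * lam * (1 - g) + usage y (S + (a : ℝ) * g * (1 - z)) j k₁ k₂ * ((1 - y) / y) * ((1 - z) * lam * g)) :
    DECAtT y (S + (a : ℝ) * g * (1 - z)) j (M + a)
      (fun p => z * (if p = 0 then (1 : ℝ) else 0) + (1 - z) * slice (fun q => TP[k₁, k₂, lam, q]) a g p) := by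
  have hyk₂ : y * (k₂ : ℝ) ≤ S := le_trans (mul_le_mul_of_nonneg_left (by exact_mod_cast hk₂M) hy0.le) hta
  rcases Nat.eq_zero_or_pos k₁ with hk₁z | hk₁pos
  · subst hk₁z
    have hk₂0 : (0 : ℝ) < k₂ := by
      have : (0 : ℝ) < 2 * (k₂ : ℝ) := lt_of_lt_of_le (by
        have ha0 : (0 : ℝ) ≤ a := Nat.cast_nonneg a
        have hg0 : 0 < g := by nlinarith
        nlinarith [mul_nonneg (mul_nonneg ha0 hg0.le) (show (0:ℝ) ≤ 1 - z by linarith)]) hk₂mid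
      linarith
    have hmean' : (1 - z) * lam * (k₂ : ℝ) = S := by rw [← hmean]; push_cast; ring
    have hheavy : y ≤ (1 - z) * lam := by
      have h1 : y * (k₂ : ℝ) ≤ (1 - z) * lam * (k₂ : ℝ) := by rw [hmean']; exact hyk₂
      exact le_of_mul_le_mul_right h1 hk₂0
    exact decAtT_movedTwoPoint_of_heavyTop y z g S lam a j M 0 k₂ hy0 hy1 hz0 hz1 hg1 hyg ha1 hS0 hk hk₂M hlam1 hmean hheavy
  · by_cases hc1 : S + (a : ℝ) * g * (1 - z) < (k₁ : ℝ) + k₂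
    · by_cases hfit : usage y (S + (a : ℝ) * g * (1 - z)) j k₁ k₂ * ((1 - z) * (1 - lam) * (1 - g))
        + usage y (S + (a : ℝ) * g * (1 - z)) j (k₁ + a) k₂ * ((1 - z) * (1 - lam) * g) ≤ (1 - z) * lam * (1 - g)
      · exact decAtT_movedTwoPoint_of_midFit y z g S lam a j M k₁ k₂ hy0 hy1 hz0 hz1 hg1 hyg ha1 hta hk hk₂M hlam0 hlam1 hmean hk₁pos
          hk₁low hPj hPlow hk₂j hk₂mid hcomp hG hc1 hfit
      · have hL : (1 - z) * lam * (1 - g) - usage y (S + (a : ℝ) * g * (1 - z)) j (k₁ + a) k₂ * ((1 - z) * (1 - lam) * g)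
            < usage y (S + (a : ℝ) * g * (1 - z)) j k₁ k₂ * ((1 - z) * (1 - lam) * (1 - g)) := by linarith [not_le.1 hfit]
        exact decAtT_movedTwoPoint_of_kink y z g S lam a j M k₁ k₂ hy0 hy1 hz0 hz1 hg1 hyg ha1 hta hk hk₂M hlam0 hlam1 hmean hk₁pos
          hk₁low hPj hPlow hk₂mid hcomp hG (by omega) hc1 hsat hL (hkink hc1 hL)
    · exact decAtT_movedTwoPoint_of_incompLow y z g S lam a j M k₁ k₂ hy0 hy1 hz0 hz1 hg1 hyg ha1 hta hk hk₂M hlam0 hlam1 hmean hk₁pos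
        hk₁low hPj hPlow hk₂j hk₂mid hcomp hG (not_lt.1 hc1) hsat

end LawDec

end Quant

end Summit.CriticalPhenomena.PercolationContinuityZ3.Theorems
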